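import Literature.Analysis.FluidPDE.NormalisedPressurePV
import HarnessLib

/-!
# A pointwise bound for the normalised pressure of a bounded, locally Lipschitz, finite-energy field

For a `C¹` velocity field `v` on `ℝ³` with `∫|v|² < ∞`, the normalised (Riesz-transform)
pressure `p̃[v](x) = -|v(x)|²/3 + p.v.∫ K(x-y)(v(y)) dy` (`normalisedPressure`, Tao 2011 (35))
is bounded at every point `x` in terms of a sup bound `M₀` for `|v|` and a sup bound `M₁` for
`‖Dv‖` on the unit ball `B̄(x,1)`, and the energy:

  `|p̃[v](x)| ≤ M₀²/3 + 8 M₀ M₁ + (∫|v|²)/(2π)`      (`abs_normalisedPressure_le_of_local_bounds`).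

This is the classical remark that the singular integral of a `C¹ ∩ L²` density is bounded
(Stein 1970, Ch. II §4: the truncated integrals of a `C¹` function against a mean-zero
homogeneous kernel are bounded uniformly in the truncation): the near field
`ε < |x-y| ≤ 1` contributes at most `8M₀M₁(1-ε)` by the zero spherical means of the kernel and the
Lipschitz bound (`abs_truncatedPressureIntegral_sub_le`, layer `NormalisedPressurePV`), the far
field `|x-y| > 1` at most `∫|v|²/(2π)` (`|K(z)(a)| ≤ |a|²/(2π|z|³)`), and the bound passes to the
principal value (`normalisedPressure_eq_of_contDiff`). The global form
(`abs_normalisedPressure_le_of_bounds`: `|v| ≤ M₀`, `‖Dv‖ ≤ M₁` everywhere) is the one used for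
bounded classical Navier–Stokes solutions after the parabolic smoothing time, where
`M₁ ≲ M₀²/ν`.

## Mathlib / tree search

Tree: `truncatedPressureIntegral_bound_holds` (`NSFiniteEnergySmoothProofs`) is the same estimate
for the TRUNCATED integrals with an existentially quantified constant; here the constant is
explicit and the bound is stated for `p̃` itself. `lean search 'abs_normalisedPressure_le'`: only
`abs_normalisedPressure_le_of_lt_norm` (far field of a compactly supported field,
`NormalisedPressureFarField`), a different regime.

## References

* E. M. Stein, *Singular integrals and differentiability properties of functions*, Princeton
  (1970) (`Stein1971`): Ch. II §4, Ch. III §1.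
* T. Tao, *Localisation and compactness properties of the Navier–Stokes global regularity
  problem*, Anal. PDE 6 (2013) = arXiv:1108.1165 (`Tao2011`): (35), (42).
-/

noncomputable section

open MeasureTheory Set Filter Topology Metric
open scoped ENNReal

namespace Literature.Analysis.FluidPDE

variable {v : EuclideanSpace ℝ (Fin 3) → EuclideanSpace ℝ (Fin 3)}

/-- **The truncated singular integrals are bounded, explicitly:** for `v ∈ C¹` with `‖v‖² ∈ L¹`,
`|v| ≤ M₀` and `|v(y) - v(x)| ≤ M₁|y - x|` on `B̄(x,1)`, and `0 < ε ≤ 1`,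
`|∫_{|x-y|>ε} K(x-y)(v(y)) dy| ≤ 8 M₀ M₁ + (∫|v|²)/(2π)`. [cite: Stein1971, Ch. II §4] -/
theorem abs_truncatedPressureIntegral_le_of_local_bounds (hv : ContDiff ℝ 1 v)
    (hv2 : Integrable fun y => ‖v y‖ ^ 2) {x : EuclideanSpace ℝ (Fin 3)} {M₀ M₁ : ℝ}
    (hM₀ : ∀ y ∈ closedBall x 1, ‖v y‖ ≤ M₀)
    (hM₁ : ∀ y ∈ closedBall x 1, ‖v y - v x‖ ≤ M₁ * ‖y - x‖) (hM₁0 : 0 ≤ M₁)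
    {ε : ℝ} (hε : ε ∈ Ioc (0 : ℝ) 1) :
    |truncatedPressureIntegral v x ε| ≤ 8 * M₀ * M₁ + (∫ y, ‖v y‖ ^ 2) / (2 * Real.pi) := by
  have hM₀0 : 0 ≤ M₀ := (norm_nonneg _).trans (hM₀ x (mem_closedBall_self zero_le_one))
  -- far field: `|T_1| ≤ ∫|v|²/(2π)`
  have hfar : |truncatedPressureIntegral v x 1| ≤ (∫ y, ‖v y‖ ^ 2) / (2 * Real.pi) := by
    rw [truncatedPressureIntegral]
    have hint := integrableOn_pressureKernel_compl_closedBall hv.continuous hv2 x one_pos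
    have hmaj : IntegrableOn (fun y => ‖v y‖ ^ 2 / (2 * Real.pi)) (closedBall x 1)ᶜ :=
      (hv2.div_const _).integrableOn
    calc |∫ y in (closedBall x 1)ᶜ, pressureKernel (x - y) (v y)|
        ≤ ∫ y in (closedBall x 1)ᶜ, |pressureKernel (x - y) (v y)| := abs_integral_le_integral_abs
      _ ≤ ∫ y in (closedBall x 1)ᶜ, ‖v y‖ ^ 2 / (2 * Real.pi) := by
          refine setIntegral_mono_on hint.abs hmaj measurableSet_closedBall.compl fun y hy => ?_
          rw [mem_compl_iff, mem_closedBall, not_le, dist_eq_norm, ← norm_neg, neg_sub] at hy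
          calc |pressureKernel (x - y) (v y)| ≤ ‖v y‖ ^ 2 / (2 * Real.pi * ‖x - y‖ ^ 3) :=
                abs_pressureKernel_le _ _
            _ ≤ ‖v y‖ ^ 2 / (2 * Real.pi * 1 ^ 3) := by gcongr
            _ = ‖v y‖ ^ 2 / (2 * Real.pi) := by rw [one_pow, mul_one]
      _ ≤ ∫ y, ‖v y‖ ^ 2 / (2 * Real.pi) :=
          setIntegral_le_integral (hv2.div_const _) (Eventually.of_forall fun y => by positivity)
      _ = (∫ y, ‖v y‖ ^ 2) / (2 * Real.pi) := integral_div _ _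
  -- near field (shell `ε < |x-y| ≤ 1`): `|T_ε - T_1| ≤ 8 M₀ M₁ (1 - ε) ≤ 8 M₀ M₁`
  have hshell : |truncatedPressureIntegral v x ε - truncatedPressureIntegral v x 1| ≤
      8 * M₀ * M₁ * (1 - ε) :=
    abs_truncatedPressureIntegral_sub_le hv hv2 hM₀ hM₁ hM₁0 hε.1 hε.2 le_rfl
  have hshell' : 8 * M₀ * M₁ * (1 - ε) ≤ 8 * M₀ * M₁ := by
    have h8 : 0 ≤ 8 * M₀ * M₁ := by positivity
    nlinarith [hε.1]
  calc |truncatedPressureIntegral v x ε|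
      = |(truncatedPressureIntegral v x ε - truncatedPressureIntegral v x 1) +
          truncatedPressureIntegral v x 1| := by rw [sub_add_cancel]
    _ ≤ 8 * M₀ * M₁ * (1 - ε) + (∫ y, ‖v y‖ ^ 2) / (2 * Real.pi) :=
        (abs_add_le _ _).trans (add_le_add hshell hfar)
    _ ≤ 8 * M₀ * M₁ + (∫ y, ‖v y‖ ^ 2) / (2 * Real.pi) := by linarith

/-- **Pointwise bound for the normalised pressure** (Stein 1970, Ch. II §4; Tao 2011, (35)): for a
`C¹` field `v` on `ℝ³` with `∫|v|² < ∞`, if `|v| ≤ M₀` and `‖Dv‖ ≤ M₁` on the unit ball `B̄(x,1)`,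
then `|p̃[v](x)| ≤ M₀²/3 + 8 M₀ M₁ + (∫|v|²)/(2π)` (local term `-|v(x)|²/3`, near field by the
cancellation of the kernel against the Lipschitz bound, far field by `|K(z)(a)| ≤ |a|²/(2π|z|³)`).
[cite: Stein1971, Ch. II §4] -/
theorem abs_normalisedPressure_le_of_local_bounds (hv : ContDiff ℝ 1 v)
    (hE : (∫⁻ x, ‖v x‖ₑ ^ 2) < ⊤) (x : EuclideanSpace ℝ (Fin 3)) {M₀ M₁ : ℝ}
    (hM₀ : ∀ y ∈ closedBall x 1, ‖v y‖ ≤ M₀) (hM₁ : ∀ y ∈ closedBall x 1, ‖fderiv ℝ v y‖ ≤ M₁) :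
    |normalisedPressure v x| ≤ M₀ ^ 2 / 3 + 8 * M₀ * M₁ + (∫ y, ‖v y‖ ^ 2) / (2 * Real.pi) := by
  have hv2 : Integrable fun y => ‖v y‖ ^ 2 :=
    integrable_sq_of_lintegral_enorm_sq_lt_top hv.continuous hE
  have hM₁0 : 0 ≤ M₁ := (norm_nonneg _).trans (hM₁ x (mem_closedBall_self zero_le_one))
  -- the Lipschitz bound on the ball from the derivative bound (mean value inequality)
  have hLip : ∀ y ∈ closedBall x 1, ‖v y - v x‖ ≤ M₁ * ‖y - x‖ := fun y hy =>
    (convex_closedBall x 1).norm_image_sub_le_of_norm_fderiv_le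
      (fun z _ => hv.differentiable one_ne_zero z) hM₁ (mem_closedBall_self zero_le_one) hy
  -- the principal value and the representation `p̃ = -|v(x)|²/3 + L`
  obtain ⟨L, hPV, hp⟩ := normalisedPressure_eq_of_contDiff hv hE x
  set B : ℝ := 8 * M₀ * M₁ + (∫ y, ‖v y‖ ^ 2) / (2 * Real.pi) with hB
  -- the truncated integrals are bounded by `B` for `0 < ε ≤ 1`, hence so is their limit `L`
  have hev : ∀ᶠ ε in 𝓝[>] (0 : ℝ), |truncatedPressureIntegral v x ε| ≤ B := by
    filter_upwards [Ioc_mem_nhdsGT one_pos] with ε hε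
    exact abs_truncatedPressureIntegral_le_of_local_bounds hv hv2 hM₀ hLip hM₁0 hε
  have hL : |L| ≤ B := le_of_tendsto hPV.2.abs hev
  -- the local term
  have hloc : ‖v x‖ ^ 2 ≤ M₀ ^ 2 :=
    pow_le_pow_left₀ (norm_nonneg _) (hM₀ x (mem_closedBall_self zero_le_one)) 2
  rw [hp]
  calc |-‖v x‖ ^ 2 / 3 + L| ≤ |-‖v x‖ ^ 2 / 3| + |L| := abs_add_le _ _
    _ = ‖v x‖ ^ 2 / 3 + |L| := by
        rw [abs_div, abs_neg, abs_of_nonneg (sq_nonneg _), abs_of_pos (by norm_num : (0:ℝ) < 3)]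
    _ ≤ M₀ ^ 2 / 3 + B := add_le_add (by linarith) hL
    _ = M₀ ^ 2 / 3 + 8 * M₀ * M₁ + (∫ y, ‖v y‖ ^ 2) / (2 * Real.pi) := by rw [hB]; ring

/-- **Global form:** if `v ∈ C¹(ℝ³; ℝ³)` has `∫|v|² < ∞`, `|v| ≤ M₀` and `‖Dv‖ ≤ M₁` everywhere,
then `|p̃[v](x)| ≤ M₀²/3 + 8 M₀ M₁ + (∫|v|²)/(2π)` at every point. (For a bounded classical
Navier–Stokes solution after the smoothing time, `M₁ ≲ M₀²/ν`.) [cite: Stein1971, Ch. II §4] -/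
theorem abs_normalisedPressure_le_of_bounds (hv : ContDiff ℝ 1 v)
    (hE : (∫⁻ x, ‖v x‖ₑ ^ 2) < ⊤) {M₀ M₁ : ℝ}
    (hM₀ : ∀ y, ‖v y‖ ≤ M₀) (hM₁ : ∀ y, ‖fderiv ℝ v y‖ ≤ M₁) (x : EuclideanSpace ℝ (Fin 3)) :
    |normalisedPressure v x| ≤ M₀ ^ 2 / 3 + 8 * M₀ * M₁ + (∫ y, ‖v y‖ ^ 2) / (2 * Real.pi) :=
  abs_normalisedPressure_le_of_local_bounds hv hE x (fun y _ => hM₀ y) fun y _ => hM₁ y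

end Literature.Analysis.FluidPDE

end
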